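import Literature.Topology.FourManifolds.OneManifoldTwoCharts
import Literature.Topology.FourManifolds.OneManifoldLocalOrder
import HarnessLib

/-!
# Every compact connected `1`-manifold is orientable

Topic `Literature/Topology/FourManifolds`. The missing half of the classification of compact
`1`-manifolds in the tree: `OneManifoldCircle.lean` proves that a compact connected *oriented*
smooth `1`-manifold is diffeomorphic to the circle
(`Literature.Topology.FourManifolds.nonempty_diffeomorph_sphere_one_of_smoothOrientation`), noting
"every `1`-manifold is orientable, but that is not proved here". This file proves it for compact
connected Hausdorff manifolds modelled on `EuclideanSpace ℝ (Fin 1)`: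

* `OneManifold.nonempty_smoothOrientation_of_compatible_arcCharts`: two real charts `e`, `f`
  covering `M` and inducing the same local order at each point of their overlap
  (`e q < e p ↔ f q < f p` near `p`) define a `SmoothOrientation (𝓡 1) M`: the tangent line at
  `y` is oriented by declaring the preferred chart at `y` positive iff its coordinate has, near
  `y`, the same direction as `e` (or `f`); the defining local constancy of a smooth orientation —
  `o y = o x ↔ 0 < det (tangentCoordChange (𝓡 1) y x y)` for `y` near `x` — is the sign rule for
  directions (`OneManifold.same_iff_same_iff`) combined with the dictionary "same direction of
  the coordinates of the charts at `x` and `y` ↔ positive Jacobian"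
  (`OneManifold.same_coord_iff_det_pos`, `OneManifoldLocalOrder.lean`);
* `OneManifold.isOrientable_of_compactSpace_of_connectedSpace` (**every compact connected
  Hausdorff `1`-manifold is orientable**): by the topological core of Milnor's classification
  (`OneManifold.exists_two_compatible_arcCharts_of_chartedSpace`, `OneManifoldTwoCharts.lean`)
  such a manifold is covered by two compatible arc charts.

Milnor (*Topology from the Differentiable Viewpoint* (1965), Appendix) obtains orientability as a
by-product of the diffeomorphism with `S¹` or an interval; Hirsch (*Differential Topology* (1976),
Ch. 1 §2, Exercise 6; §4.4) likewise. All statements here are **proved**; no definitions or named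
facts are introduced.

## References

* J. Milnor, *Topology from the Differentiable Viewpoint*, Univ. Press of Virginia (1965),
  Appendix "Classifying 1-manifolds", pp. 55–57. [MilnorTDV1965]
* M. W. Hirsch, *Differential Topology*, GTM 33 (1976), Ch. 1 §2 Exercise 6, §4.4.
  [HirschDT1976]
-/

open Set Filter Topology Module
open scoped Manifold ContDiff

noncomputable section

namespace Literature.Topology.FourManifolds

namespace OneManifold

variable {M : Type*} [TopologicalSpace M] [ChartedSpace (EuclideanSpace ℝ (Fin 1)) M]

/-- **Along an interval of a real chart `e` around `x`, the coordinate of a preferred chart has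
constantly the same, or constantly the opposite, direction as `e`.** For `x ∈ e.source` in the
domain of the preferred chart at `z`, there is a neighbourhood `N` of `x` such that either at
every `y ∈ N` the coordinate `(extChartAt (𝓡 1) z ·) 0` and `e` have the same direction, or at
every `y ∈ N` they have opposite directions (the coordinate read in `e` is monotone on an
interval, `exists_interval_strictMonoOn_or_strictAntiOn`). [folklore] -/
theorem exists_nhds_same_or_opp (e : OpenPartialHomeomorph M ℝ) {x : M} (hx : x ∈ e.source)
    (z : M) (hxz : x ∈ (extChartAt (𝓡 1) z).source) :
    ∃ N ∈ 𝓝 x,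
      (∀ y ∈ N, ∀ᶠ q in 𝓝 y,
        ((extChartAt (𝓡 1) z q) 0 < (extChartAt (𝓡 1) z y) 0 ↔ e q < e y) ∧
          ((extChartAt (𝓡 1) z y) 0 < (extChartAt (𝓡 1) z q) 0 ↔ e y < e q)) ∨
      ∀ y ∈ N, ∀ᶠ q in 𝓝 y,
        ((extChartAt (𝓡 1) z q) 0 < (extChartAt (𝓡 1) z y) 0 ↔ e y < e q) ∧
          ((extChartAt (𝓡 1) z y) 0 < (extChartAt (𝓡 1) z q) 0 ↔ e q < e y) := by
  obtain ⟨J, hJo, hxJ, hJt, -, hJ⟩ := exists_interval_strictMonoOn_or_strictAntiOn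
    (isOpen_extChartAt_source z) hxz (continuousOn_coord z) (injOn_coord z) hx
  have hNo : IsOpen (e.symm '' J) := e.isOpen_image_symm_of_subset_target hJo hJt
  have hxN : x ∈ e.symm '' J := ⟨e x, hxJ, e.left_inv hx⟩
  refine ⟨e.symm '' J, hNo.mem_nhds hxN, ?_⟩
  rcases hJ with hmono | hanti
  · exact Or.inl fun y hy => same_symm (eventually_lt_iff_of_strictMonoOn hJo hJt hmono hy)
  · exact Or.inr fun y hy => opp_symm (eventually_gt_iff_of_strictAntiOn hJo hJt hanti hy)

variable [IsManifold (𝓡 1) 1 M]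

/-- **Two compatible real charts covering a `1`-manifold orient it.** Let `e`, `f` be open partial
homeomorphisms `M ⇀ ℝ` whose sources cover the `C¹` manifold `M` (modelled on `ℝ¹`) and which
induce the same local order at every point of the overlap (`e q < e p ↔ f q < f p` and
`e p < e q ↔ f p < f q` for `q` near `p`). Then `M` carries a `SmoothOrientation (𝓡 1)`: orient
the tangent line at `y` positively (`μ₀`) iff the coordinate of the preferred chart at `y` has,
near `y`, the same direction as the reference chart at `y` (`e` on `e.source`, `f` elsewhere —
by compatibility the choice is immaterial on the overlap). For `y` near `x` the condition
`o y = o x` then says that the charts at `x` and `y` have the same direction relative to a common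
reference, i.e. relative to each other (sign rule `same_iff_same_iff`, using that the direction
of the chart at `x` relative to the reference is locally constant, `exists_nhds_same_or_opp`),
which is `0 < det (tangentCoordChange (𝓡 1) y x y)` (`same_coord_iff_det_pos`). Orientations as
signs of Jacobians: Hirsch, *Differential Topology* (1976), §4.4. [cite: HirschDT1976, §4.4] -/
theorem nonempty_smoothOrientation_of_compatible_arcCharts {e f : OpenPartialHomeomorph M ℝ}
    (hcov : e.source ∪ f.source = univ)
    (hcompat : ∀ p ∈ e.source ∩ f.source, ∀ᶠ q in 𝓝 p,
      (e q < e p ↔ f q < f p) ∧ (e p < e q ↔ f p < f q)) :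
    Nonempty (SmoothOrientation (𝓡 1) M) := by
  classical
  obtain ⟨μ₀⟩ := nonempty_orientation (EuclideanSpace ℝ (Fin 1))
  -- coordinates of the preferred charts and the reference chart at each point
  set c : M → M → ℝ := fun z q => (extChartAt (𝓡 1) z q) 0 with hc
  set ρ : M → M → ℝ := fun y => if y ∈ e.source then (e : M → ℝ) else (f : M → ℝ) with hρ
  refine ⟨
    { toFun := fun y =>
        if ∀ᶠ q in 𝓝 y, (c y q < c y y ↔ ρ y q < ρ y y) ∧ (c y y < c y q ↔ ρ y y < ρ y q)
        then μ₀ else -μ₀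
      eventually_eq_iff' := fun x => ?_ }⟩
  -- a reference chart `r` valid on a whole neighbourhood of `x`
  obtain ⟨r, hxr, hρr⟩ : ∃ r : OpenPartialHomeomorph M ℝ, x ∈ r.source ∧
      ∀ᶠ y in 𝓝 x, y ∈ r.source ∧ ∀ u : M → ℝ,
        ((∀ᶠ q in 𝓝 y, (u q < u y ↔ ρ y q < ρ y y) ∧ (u y < u q ↔ ρ y y < ρ y q)) ↔
          ∀ᶠ q in 𝓝 y, (u q < u y ↔ r q < r y) ∧ (u y < u q ↔ r y < r q)) := by
    by_cases hxe : x ∈ e.source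
    · refine ⟨e, hxe, ?_⟩
      filter_upwards [e.open_source.mem_nhds hxe] with y hy
      refine ⟨hy, fun u => ?_⟩
      simp only [hρ, if_pos hy]
    · have hxf : x ∈ f.source := by
        have hx : x ∈ e.source ∪ f.source := by rw [hcov]; trivial
        exact hx.resolve_left hxe
      refine ⟨f, hxf, ?_⟩
      filter_upwards [f.open_source.mem_nhds hxf] with y hyf
      refine ⟨hyf, fun u => ?_⟩
      by_cases hye : y ∈ e.source
      · simp only [hρ, if_pos hye]
        have hef := hcompat y ⟨hye, hyf⟩
        exact ⟨fun h => same_trans h hef, fun h => same_trans h (same_symm hef)⟩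
      · simp only [hρ, if_neg hye]
  -- near `x`, the chart at `x` has constantly the same or the opposite direction as `r`
  obtain ⟨N, hN, hQ⟩ := exists_nhds_same_or_opp r hxr x (mem_extChartAt_source x)
  filter_upwards [hρr, hN, (isOpen_extChartAt_source (I := 𝓡 1) x).mem_nhds
    (mem_extChartAt_source x)] with y hy hyN hyx
  obtain ⟨hyr, hρy⟩ := hy
  obtain ⟨-, hρx⟩ := hρr.self_of_nhds
  rw [ite_eq_ite_iff_iff, hρy (c y), hρx (c x)]
  -- charts are not locally constant
  have hr_x : ¬∀ᶠ q in 𝓝 x, r q = r x := not_eventually_chart_eq hxr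
  have hr_y : ¬∀ᶠ q in 𝓝 y, r q = r y := not_eventually_chart_eq hyr
  have hcy : ¬∀ᶠ q in 𝓝 y, c y q = c y y := not_eventually_coord_eq (mem_extChartAt_source y)
  -- the chart at `y` and the chart at `x` each have the same or the opposite direction as `r`
  obtain ⟨N', hN', hP⟩ := exists_nhds_same_or_opp r hyr y (mem_extChartAt_source y)
  have hPy := hP.imp (fun h => h y (mem_of_mem_nhds hN')) fun h => h y (mem_of_mem_nhds hN')
  have hQy := hQ.imp (fun h => h y hyN) fun h => h y hyN
  -- the direction of the chart at `x` relative to `r` is the same at `x` and at `y`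
  have hconst : (∀ᶠ q in 𝓝 x, (c x q < c x x ↔ r q < r x) ∧ (c x x < c x q ↔ r x < r q)) ↔
      ∀ᶠ q in 𝓝 y, (c x q < c x y ↔ r q < r y) ∧ (c x y < c x q ↔ r y < r q) := by
    rcases hQ with h | h
    · exact iff_of_true (h x (mem_of_mem_nhds hN)) (h y hyN)
    · exact iff_of_false (fun h' => not_same_and_opp hr_x h' (h x (mem_of_mem_nhds hN)))
        fun h' => not_same_and_opp hr_y h' (h y hyN)
  rw [hconst, same_iff_same_iff hr_y hcy hPy hQy]
  exact same_coord_iff_det_pos hyx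

/-- **Every compact connected Hausdorff `1`-manifold is orientable.** A compact connected
Hausdorff `C¹` manifold modelled on `EuclideanSpace ℝ (Fin 1)` admits a `SmoothOrientation`: it
is covered by two compatible arc charts (the topological core of Milnor's classification of
one-manifolds, `exists_two_compatible_arcCharts_of_chartedSpace`), which orient it
(`nonempty_smoothOrientation_of_compatible_arcCharts`). Milnor, *Topology from the Differentiable
Viewpoint* (1965), Appendix; Hirsch, *Differential Topology* (1976), Ch. 1 §2, Exercise 6.
[cite: MilnorTDV1965, Appendix (Classifying 1-manifolds), Theorem pp. 56–57] -/
theorem isOrientable_of_compactSpace_of_connectedSpace [T2Space M] [CompactSpace M]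
    [ConnectedSpace M] : IsOrientable (𝓡 1) M := by
  obtain ⟨e, f, -, -, hcov, hcompat⟩ := exists_two_compatible_arcCharts_of_chartedSpace (M := M)
  exact nonempty_smoothOrientation_of_compatible_arcCharts hcov hcompat

end OneManifold

end Literature.Topology.FourManifolds
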